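import Summits.CriticalPhenomena.CardyFormulaZ2.Theorems.CardyUniqueLimitCardyRigidityFarFieldEngine
import Summits.CriticalPhenomena.CardyFormulaZ2.Theorems.CardyUniqueLimitCardyRigidityMvpRigidity

/-!
# STUB C′ `stub_kernelAffineCardy` of line `crossing-martingale` (crux `CardyRigidity`, stmt-CriticalPhenomena-0746)

The registered analysis stub of the checked skeleton `Cruxes/CardyRigidity/Lines/crossing_martingale.lean`
(v2, sha `f0871145…`):

    ∀ f, ContinuousOn f (0,1) → ∀ (Ω, μ) (W, 𝓕), IsRegularDriver μ W 𝓕 →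
      IsCrossingMartingaleFamily f μ W 𝓕 → ∃ A B, f = A·I_{2/3} + B on (0,1).

It is the composition of the two landed halves:

* ENGINE (`FarField.moments`, `…FarFieldEngine`, p150268): for a regular driver, a shape
  `0 < a < b < c` and the time `t = 1`, the increments `h n` of the level-stopped modulus of the marks
  `n·(a,b,c)` are eventually measurable, surely `O(n^{-1/4})`, with `n E[h n] → -S₁ E[W₁]`,
  `n² E[(h n)²] → S₁² E[W₁²]` and, if `E[W₁] = 0`, `n² E[h n] → 2 S₂ - (S₁/b) E[W₁²]`;
* ANALYSIS (`Mvp.affineCardy_of_mvpData`, `…MvpRigidity`, p149898): such asymptotic mean-value data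
  at every shape, together with the EXACT identity `∫ f(η̂ + x) dν_n = f η̂` for the laws `ν_n` of the
  increments, force a continuous kernel to be affine in `I_{2/3}`.

The glue proved here (`FarField.mvp_package`): the laws `ν_n = (h n)_* μ` of the increments are the
mean-value package the analysis half consumes — probability measures carried by `[-r_n, r_n]` with
`r_n = |C| n^{3/4}/n → 0`, whose first two moments are the engine's, and for which the exact identity
is the crossing-martingale property (`FarField.integral_crossingObs_eq`) transported along the
pushforward and the scale invariance of the modulus (`FarField.cardyEta_mul`).  The kernel is first
replaced by its measurable modification `(0,1).piecewise f 0` (the observables only read the kernel on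
`(0,1)`, `crossingObs_congr`), so that the change of variables under the pushforward is available for a
kernel that is merely continuous on `(0,1)`.
-/

noncomputable section

open MeasureTheory Filter Set Topology
open scoped NNReal ENNReal
open Literature.Probability.RandomPlanarGeometry

namespace Summit.CriticalPhenomena.CardyFormulaZ2.Cruxes.CardyRigidity.CrossingMartingale

namespace FarField

section Package

variable {Ω : Type*} {mΩ : MeasurableSpace Ω} {μ : Measure Ω} [IsProbabilityMeasure μ]
  {W : Ω → ℝ≥0 → ℝ} {𝓕 : Filtration ℝ≥0 mΩ} {a b c : ℝ}

/-- **The mean-value package of a crossing-martingale kernel at one shape.**  For a regular driver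
`W`, a measurable kernel `f` with the crossing-martingale property and a shape `0 < a < b < c`, the
laws `ν_n` of the increments of the level-stopped modulus of the marks `n·(a,b,c)` at time `1` are
probability measures carried by `[-r_n, r_n]`, `r_n → 0`, satisfy the exact identity
`∫ f(η̂ + x) dν_n = f η̂` (`η̂ = cardyEta a b c`), and have the asymptotic moments
`n ∫ x dν_n → -S₁ E[W₁]`, `n² ∫ x² dν_n → S₁² E[W₁²]`, and (if `E[W₁] = 0`)
`n² ∫ x dν_n → 2 (a⁻¹+b⁻¹+c⁻¹) S₁ - (S₁/b) E[W₁²]`, in the format consumed by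
`Mvp.affineCardy_of_mvpData`. [cite: LawlerSchrammWerner2001, §3] -/
theorem mvp_package (hreg : IsRegularDriver μ W 𝓕) {f : ℝ → ℝ} (hfm : Measurable f)
    (hmart : IsCrossingMartingaleFamily f μ W 𝓕) (ha : 0 < a) (hab : a < b) (hbc : b < c) :
    ∃ (r : ℕ → ℝ) (ν : ℕ → Measure ℝ) (L₁ L₂ M₁ : ℝ), Tendsto r atTop (𝓝 0) ∧
      (∀ᶠ n in atTop, IsProbabilityMeasure (ν n) ∧ ν n (Icc (-(r n)) (r n))ᶜ = 0 ∧
        ∫ x, f (cardyEta a b c + x) ∂(ν n) = f (cardyEta a b c)) ∧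
      Tendsto (fun n : ℕ ↦ (n : ℝ) * ∫ x, x ∂(ν n)) atTop (𝓝 L₁) ∧
      Tendsto (fun n : ℕ ↦ (n : ℝ) ^ 2 * ∫ x, x ^ 2 ∂(ν n)) atTop (𝓝 L₂) ∧
      ((∫ ω, W ω 1 ∂μ) = 0 → Tendsto (fun n : ℕ ↦ (n : ℝ) ^ 2 * ∫ x, x ∂(ν n)) atTop (𝓝 M₁)) ∧
      L₁ = -((c - b) * (b - a) / ((c - a) * b ^ 2)) * (∫ ω, W ω 1 ∂μ) ∧
      L₂ = ((c - b) * (b - a) / ((c - a) * b ^ 2)) ^ 2 * (∫ ω, (W ω 1) ^ 2 ∂μ) ∧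
      M₁ = 2 * (a⁻¹ + b⁻¹ + c⁻¹) * ((c - b) * (b - a) / ((c - a) * b ^ 2)) +
        (∫ ω, (W ω 1) ^ 2 ∂μ) / 2 * (-2 * ((c - b) * (b - a)) / ((c - a) * b ^ 3)) := by
  have hWc : ∀ ω, Continuous (W ω) := hreg.2.1
  have hW0 : ∀ ω, W ω 0 = 0 := hreg.2.2.1
  have hb : 0 < b := ha.trans hab
  have hc : 0 < c := hb.trans hbc
  have hca : 0 < c - a := by linarith
  -- the increments of the stopped modulus at scale `n`, time `1`
  set h : ℕ → Ω → ℝ := fun n ω ↦ etaProc W (fun i ↦ (n : ℝ) * ![a, b, c] i)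
      (min ((1 : ℝ≥0) : WithTop ℝ≥0) (levelTime W (fun i ↦ (n : ℝ) * ![a, b, c] i)
        (n * a - (n : ℝ) ^ (3 / 4 : ℝ)) (n * a + (n : ℝ) ^ (3 / 4 : ℝ))
        (n * min (b - a) (c - b) - (n : ℝ) ^ (3 / 4 : ℝ)) ω)).untopA ω - cardyEta a b c with hh
  obtain ⟨hhm, ⟨C, hsure⟩, h1, h2, h3⟩ :=
    FarField.moments hreg ha hab hbc (t := 1) one_pos (h := h) (fun n ω ↦ rfl)
  -- the package
  set m : ℝ := ∫ ω, W ω 1 ∂μ with hm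
  set v : ℝ := ∫ ω, (W ω 1) ^ 2 ∂μ with hv
  set S₁ : ℝ := (c - b) * (b - a) / ((c - a) * b ^ 2) with hS₁
  refine ⟨fun n ↦ |C| * ((n : ℝ)) ^ (3 / 4 : ℝ) / n, fun n ↦ Measure.map (h n) μ,
    -S₁ * m, S₁ ^ 2 * v, 2 * (a⁻¹ + b⁻¹ + c⁻¹) * S₁ + v / 2 * (-2 * ((c - b) * (b - a)) /
      ((c - a) * b ^ 3)), ?_, ?_, ?_, ?_, ?_, rfl, rfl, rfl⟩
  · -- `r n → 0`
    have := tendsto_scale_div.const_mul |C|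
    rw [mul_zero] at this
    refine this.congr' (Eventually.of_forall fun n ↦ ?_)
    simp only [mul_div_assoc]
  · -- probability laws carried by `[-r n, r n]`, and the exact identity
    have hscale := eventually_scale ha hab hbc (1 : ℝ) zero_le_one
    filter_upwards [hhm, hsure, hscale] with n hn hsn hsc
    obtain ⟨hn0, hq, -, -, -, -⟩ := hsc
    have hnpos : (0 : ℝ) < n := by exact_mod_cast hn0
    have hadm := admissibleLevels_scale ha hab hbc hn0 hq
    refine ⟨Measure.isProbabilityMeasure_map hn.aemeasurable, ?_, ?_⟩
    · -- the support
      rw [Measure.map_apply hn measurableSet_Icc.compl]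
      have hempty : h n ⁻¹' (Icc (-(|C| * ((n : ℝ)) ^ (3 / 4 : ℝ) / n))
          (|C| * ((n : ℝ)) ^ (3 / 4 : ℝ) / n))ᶜ = ∅ := by
        ext ω
        simp only [mem_preimage, mem_compl_iff, mem_Icc, mem_empty_iff_false, iff_false, not_not]
        refine abs_le.1 ((hsn ω).trans ?_)
        have hq0 : 0 ≤ ((n : ℝ)) ^ (3 / 4 : ℝ) / n := by positivity
        rw [mul_div_assoc, mul_div_assoc]
        exact mul_le_mul_of_nonneg_right (le_abs_self C) hq0
      rw [hempty, measure_empty]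
    · -- the exact identity: martingale expectation, transported along the pushforward
      have hint : ∫ x, f (cardyEta a b c + x) ∂(Measure.map (h n) μ) =
          ∫ ω, f (cardyEta a b c + h n ω) ∂μ :=
        integral_map (f := fun x ↦ f (cardyEta a b c + x)) hn.aemeasurable
          (hfm.comp (measurable_const_add _)).aestronglyMeasurable
      rw [hint]
      have hobs : ∀ ω, f (cardyEta a b c + h n ω) =
          crossingObs f W (fun i ↦ (n : ℝ) * ![a, b, c] i) (n * a - (n : ℝ) ^ (3 / 4 : ℝ))
            (n * a + (n : ℝ) ^ (3 / 4 : ℝ)) (n * min (b - a) (c - b) - (n : ℝ) ^ (3 / 4 : ℝ)) 1 ω := by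
        intro ω
        simp only [hh, add_sub_cancel]
        rfl
      simp_rw [hobs]
      rw [integral_crossingObs_eq hWc hW0 hmart hadm 1]
      show f (cardyEta ((n : ℝ) * ![a, b, c] 0) ((n : ℝ) * ![a, b, c] 1) ((n : ℝ) * ![a, b, c] 2)) =
        f (cardyEta a b c)
      have e0 : ![a, b, c] 0 = a := rfl
      have e1 : ![a, b, c] 1 = b := rfl
      have e2 : ![a, b, c] 2 = c := rfl
      rw [e0, e1, e2, cardyEta_mul hnpos.ne']
  · -- first moment
    have hint : ∀ᶠ n : ℕ in atTop, ∫ x, x ∂(Measure.map (h n) μ) = ∫ ω, h n ω ∂μ := by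
      filter_upwards [hhm] with n hn
      exact integral_map hn.aemeasurable aestronglyMeasurable_id
    have e : -((b - a) * (c - b) / (b ^ 2 * (c - a)) * ∫ ω, W ω 1 ∂μ) = -S₁ * m := by
      rw [hS₁, hm]; ring
    rw [← e]
    refine h1.congr' ?_
    filter_upwards [hint] with n hn
    rw [hn]
  · -- second moment
    have hint : ∀ᶠ n : ℕ in atTop, ∫ x, x ^ 2 ∂(Measure.map (h n) μ) = ∫ ω, (h n ω) ^ 2 ∂μ := by
      filter_upwards [hhm] with n hn
      exact integral_map hn.aemeasurable (measurable_id.pow_const 2).aestronglyMeasurable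
    have e : ((b - a) * (c - b) / (b ^ 2 * (c - a))) ^ 2 * ∫ ω, (W ω 1) ^ 2 ∂μ = S₁ ^ 2 * v := by
      rw [hS₁, hv]; ring
    rw [← e]
    refine h2.congr' ?_
    filter_upwards [hint] with n hn
    rw [hn]
  · -- centred first moment at second order
    intro hm0
    have hint : ∀ᶠ n : ℕ in atTop, ∫ x, x ∂(Measure.map (h n) μ) = ∫ ω, h n ω ∂μ := by
      filter_upwards [hhm] with n hn
      exact integral_map hn.aemeasurable aestronglyMeasurable_id
    have e : 2 * ((1 : ℝ≥0) : ℝ) * ((b - a) * (c - b) / (b ^ 2 * (c - a)) *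
        ((a * b + b * c + c * a) / (a * b * c))) -
        (b - a) * (c - b) / (b ^ 2 * (c - a)) / b * ∫ ω, (W ω 1) ^ 2 ∂μ =
        2 * (a⁻¹ + b⁻¹ + c⁻¹) * S₁ + v / 2 * (-2 * ((c - b) * (b - a)) / ((c - a) * b ^ 3)) := by
      rw [hS₁, hv, NNReal.coe_one]
      field_simp
      ring
    rw [← e]
    refine (h3 hm0).congr' ?_
    filter_upwards [hint] with n hn
    rw [hn]

end Package

end FarField

/-- **STUB C′ `stub_kernelAffineCardy`** (registered stub of line `crossing-martingale`, crux
`CardyRigidity`, stmt-CriticalPhenomena-0746): if a regular driving process makes all level-stopped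
one-sided `f`-crossing observables martingales and `f` is continuous on `(0,1)`, then
`f = A·I_{2/3} + B` on `(0,1)` for some constants `A, B`.  Proof: the far-field mean-value package
(`FarField.mvp_package`, for the measurable modification `(0,1).piecewise f 0` of the kernel, which has
the same crossing observables) feeds the analysis half `Mvp.affineCardy_of_mvpData`.
[cite: LawlerSchrammWerner2001, §3] [cite: Cardy1992, eq. (8)] -/
theorem stub_kernelAffineCardy :
    ∀ f : ℝ → ℝ, ContinuousOn f (Ioo 0 1) →
      ∀ (Ω : Type) [MeasurableSpace Ω] (μ : Measure Ω) [IsProbabilityMeasure μ]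
        (W : Ω → ℝ≥0 → ℝ) (𝓕 : Filtration ℝ≥0 ‹MeasurableSpace Ω›),
        IsRegularDriver μ W 𝓕 → IsCrossingMartingaleFamily f μ W 𝓕 →
          ∃ A B : ℝ, EqOn f (fun η ↦ A * betaLaw (2 / 3) η + B) (Ioo 0 1) := by
  intro f hf Ω _ μ _ W 𝓕 hreg hmart
  have hWc : ∀ ω, Continuous (W ω) := hreg.2.1
  have hW0 : ∀ ω, W ω 0 = 0 := hreg.2.2.1
  -- the measurable modification of the kernel
  set g : ℝ → ℝ := (Ioo (0 : ℝ) 1).piecewise f 0 with hg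
  have hgf : EqOn g f (Ioo 0 1) := Set.piecewise_eqOn _ _ _
  have hgc : ContinuousOn g (Ioo 0 1) := hf.congr hgf
  have hgm : Measurable g := hf.measurable_piecewise continuousOn_const measurableSet_Ioo
  have hmart' : IsCrossingMartingaleFamily g μ W 𝓕 := by
    intro x m M d h
    rw [crossingObs_congr hgf hWc hW0 h]
    exact hmart x m M d h
  -- the mean-value data of `g` at every shape, and the analysis half
  have hv : 0 ≤ ∫ ω, (W ω 1) ^ 2 ∂μ := integral_nonneg fun ω ↦ sq_nonneg _
  obtain ⟨A, B, hAB⟩ := Mvp.affineCardy_of_mvpData hgc hv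
    (fun a b c ha hab hbc ↦ FarField.mvp_package hreg hgm hmart' ha hab hbc)
  exact ⟨A, B, fun η hη ↦ (hgf hη).symm.trans (hAB hη)⟩

end Summit.CriticalPhenomena.CardyFormulaZ2.Cruxes.CardyRigidity.CrossingMartingale

end
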